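import Literature.AlgebraicGeometry.Motives.HodgeStructureEndActionBlockDimensionNonsplit
import HarnessLib

/-!
# «`C(A) ⊗ k = C₁ × ⋯ × C_t`, `Cᵢ = End_{Fᵢ}(Vᵢ) ≈ M_{2g/f}(Fᵢ)`» FOR EVERY FIELD `K ⊇ ℚ`: THE COMMUTANT OF `F` ON `K ⊗ V` IS
# `M_d(K ⊗_ℚ F)` AS A `K`-ALGEBRA, `d = dim_ℚ V/[F:ℚ]`; `dim_K C_K(F) = d²·[F:ℚ]`, block commutant `C_K(F)·ι_K(u) ≅ M_d(u·(K ⊗ F))`,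
# `dim_K Cᵢ = d²·[Fᵢ : K]` at a factor `Fᵢ = (K ⊗ F)/𝔪ᵢ`, `Σᵢ dim_K Cᵢ = dim_K C_K(F)`; «`α = α₁ ⊕ ⋯ ⊕ α_t`, `αᵢ : Vᵢ → Vᵢ`»
# (Milne 1999 §2 p. 646 L52–L54, type I p. 648 L42–L52, Prop. 2.1)

[topic AlgebraicGeometry/Motives]

Layer `Literature/AlgebraicGeometry/Motives`, lane `lit-hodgefound` (Track 2 foundations library; prover seat
`lit-hodgefound-p02`, generation 56, self-proposed row g56-#14; theme «`C₀ ⊗ k` and its factor fields along a field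
extension»; sequel of g56-#13 `Motives/HodgeStructureEndActionBlockDimensionNonsplit`). THEOREMS ONLY: no definition, no
named fact (net debt `0`), no instance, no notation.

Milne, §2 p. 646: «Any `k`-linear map `α : V → V` commuting with the action of `F` decomposes into `α = α₁ ⊕ ⋯ ⊕ α_t`,
`αᵢ : Vᵢ → Vᵢ`, `Fᵢ`-linear», and for type I (`E = F`) p. 648: «`C(A) = C₁ × ⋯ × C_t`, `Cᵢ = End_{Fᵢ}(Vᵢ) ≈ M_{2g/f}(Fᵢ)`».
On the present carrier (`A : EndAction H F`, ANY field `K ⊇ ℚ`, `ι_K = baseChangeAction K A.ι : K ⊗_ℚ F →ₐ[K] End_K(K ⊗_ℚ V)`)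
the COMMUTANT OF `F` is `C_K(F) = Subalgebra.centralizer K (range ι_K)` — the `K`-linear maps of `K ⊗ V` commuting with every
`ι(a)_K` (`mem_centralizer_range_baseChangeAction_iff`) — and g56-#13 made `K ⊗ V ≅ (K ⊗ F)^d` as a `(K ⊗ F)`-module through
g20's bijection `Ψ`.  Transporting along `Ψ`:
(i) **`C_K(F) ≃ₐ[K] M_d(K ⊗_ℚ F)`**, `Φ(M) = Ψ ∘ (M *ᵥ ·) ∘ Ψ⁻¹`, with `Φ(u • M) = ι_K(u) Φ(M)` («`Cᵢ = End_{Fᵢ}(Vᵢ) ≈ M_{2g/f}(Fᵢ)`»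
all factors at once: `M_d(∏ Fᵢ) = ∏ M_d(Fᵢ)`), for EVERY field `K` (no splitting);
(ii) `dim_K C_K(F) = d²·[F:ℚ]` (independent of `K`: «`C'(A) ≅ C(A) ⊗_k k'`», Remark 1.6);
(iii) the block commutant `Cᵤ = C_K(F)·ι_K(u)` has `dim_K Cᵤ = d² · dim_K u·(K ⊗ F)` for every `u ∈ K ⊗ F`, so at a maximal ideal `𝔪`
with primitive idempotent `e_𝔪`: **`dim_K C_K(F)·ι_K(e_𝔪) = d² · [(K ⊗ F)/𝔪 : K]`** («`Cᵢ ≈ M_{2g/f}(Fᵢ)`» counted over `K`), and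
`Σ_𝔪 dim_K C_𝔪 = dim_K C_K(F)` («`C(A) ⊗ k = C₁ × ⋯ × C_t`» counted);
(iv) every `γ ∈ C_K(F)` preserves each `ι_K(u)(K ⊗ V)` and `ker ι_K(u)`, and `γ = Σᵢ γ ι_K(eᵢ)` for `1 = Σ eᵢ` («`α = α₁ ⊕ ⋯ ⊕ α_t`»).

## The source, verbatim

J. S. Milne, *Lefschetz classes on abelian varieties*, Duke Math. J. **96** (1999) 639–675 [Milne1999LefschetzClasses]
(held `paper:doi-10-1215-s0012-7094-99-09620-5`; Duke page = folio + 638). §2 p. 646 (p0008) L43–L54: «Let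
`F ⊗_ℚ k = F₁ × ⋯ × F_t`, be the decomposition of `F ⊗_ℚ k` into a product of fields … `Vᵢ = eᵢV = V ⊗_{F ⊗_ℚ k} Fᵢ`.
Proposition 2.1 below shows that `Vᵢ` has dimension `2g/f` over `Fᵢ`. Any `k`-linear map `α : V → V` commuting with the action
of `F` decomposes into `α = α₁ ⊕ ⋯ ⊕ α_t`, `αᵢ : Vᵢ → Vᵢ`, `Fᵢ`-linear.» p. 648 (p0010) L42–L52 (simple abelian variety of type I,
`E = F`): «Corresponding to the decomposition `F ⊗_ℚ k = ∏ᵢ₌₁ᵗ Fᵢ` of `F ⊗_ℚ k` into a product of fields, there is a decomposition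
`(V(A), φ) = (V₁, φ₁) ⊕ ⋯ ⊕ (V_t, φ_t)`, `(Vᵢ, φᵢ) = (V(A), φ) ⊗_{F ⊗_ℚ k} Fᵢ`. Here `φᵢ` is a nondegenerate skew-symmetric form
on the `Fᵢ`-vector space `Vᵢ`. Therefore, `C(A) = C₁ × ⋯ × C_t`, `Cᵢ = End_{Fᵢ}(Vᵢ) ≈ M_{2g/f}(Fᵢ)` and the involution sends an
element of `Cᵢ` to its adjoint with respect to `φᵢ`.» §1 Remark 1.6 (p. 644): «`C'(A) ≅ C(A) ⊗_k k'`».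

## What is PROVED (namespace `Literature.AlgebraicGeometry.Motives.HodgeStructure.EndAction`)

* **`mem_centralizer_range_baseChangeAction_iff`** (`γ ∈ C_K(F)` iff `γ` commutes with every `ι(a)_K`);
  **`map_range_baseChangeAction_le_of_mem_centralizer`** (`γ ∈ C_K(F)` preserves `ι_K(u)(K ⊗ V)` and `ker ι_K(u)`);
  **`eq_sum_mul_baseChangeAction`** (`γ = Σᵢ γ ι_K(eᵢ)` when `Σ eᵢ = 1`).
* **`exists_matrix_algEquiv_centralizer_range_baseChangeAction`**: `∃ d, Φ : M_d(K ⊗_ℚ F) ≃ₐ[K] C_K(F)` with `d·[F:ℚ] = dim_ℚ V`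
  and `Φ(u • M) = ι_K(u)·Φ(M)`; **`finrank_centralizer_range_baseChangeAction`** (`dim_K C_K(F) = d²·[F:ℚ]`);
  **`finrank_map_mulRight_centralizer_eq`** (`dim_K C_K(F)·ι_K(u) = d² · dim_K u·(K ⊗ F)`);
  **`finrank_map_mulRight_centralizer_eq_of_notMem`** (`dim_K C_K(F)·ι_K(e_𝔪) = d² · [(K ⊗ F)/𝔪 : K]`);
  **`sum_finrank_map_mulRight_centralizer_eq`** (`Σ_𝔪 dim_K C_𝔪 = dim_K C_K(F)`).

NOT here: the involution `γ ↦ γ^†` on `C_K(F)` and its transport to `M ↦ φ⁻¹ Mᵀ φ` (the pairing `φᵢ`; g20-#3 has the split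
case); the commutant of the FULL `E_φ ⊗ K` for types II–IV (`E ≠ F`); `C_K(F)·ι_K(e)` as a (non-unital) subalgebra isomorphic
to `M_d(e(K ⊗ F))` as an ALGEBRA (only its `K`-dimension is recorded).

Nearest tree results, BY NAME: g56-#13 `EndAction.baseChange_apply_ι_mul`, `finrank_range_mulLeft_eq_finrank_quotient`,
`isReduced_baseChange_numberField`, `sum_finrank_quotient_baseChange_eq_finrank`; g20 `EndAction.exists_bijective_sum_baseChange_apply_ι`,
`forall_baseChangeAction_comm_of_forall_baseChange_comm`; split case: `EndAction.finrank_blockEnd`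
(`Motives/HodgeStructureEndAlgCentralizerBlocks`), `EndAction.centralizerBaseChangeAlgEquivCornerBlocks`
(`Motives/HodgeStructureLefschetzGroupCentralFieldSplitting`); Mathlib `Matrix.mulVec_mulVec`, `AlgHom.ofLinearMap`, `AlgEquiv.ofBijective`.

## References

* [Milne1999LefschetzClasses] J. S. Milne, *Lefschetz classes on abelian varieties*, Duke Math. J. 96 (1999) 639–675, §2
  p. 646 L43–L54, p. 648 L42–L52, Prop. 2.1 (p. 647), §1 Remark 1.6 (p. 644).
* [Deligne1982HodgeCycles] P. Deligne, *Hodge cycles on abelian varieties*, LNM 900 (1982), §4 (proof of Prop. 4.4).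
-/

noncomputable section

open scoped TensorProduct

namespace Literature.AlgebraicGeometry.Motives

namespace HodgeStructure

namespace EndAction

universe v uK

variable {V : Type v} [AddCommGroup V] [Module ℚ V] {n : ℤ} {H : HodgeStructure V n}
variable {F : Type*} [Field F] [NumberField F]
variable (K : Type uK) [Field K] [Algebra ℚ K] (A : EndAction H F)

omit [Algebra ℚ K] in
/-- `dim_K {M.map f} = #m · #n · dim_K f(M₁)`: the range of a linear map applied entrywise to `m × n` matrices. [folklore] -/
private theorem finrank_range_mapMatrix₅₇₅ {M₁ M₂ : Type*} [AddCommGroup M₁] [Module K M₁] [AddCommGroup M₂] [Module K M₂]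
    [FiniteDimensional K M₂] (f : M₁ →ₗ[K] M₂) (m n : Type*) [Fintype m] [Fintype n] :
    Module.finrank K (LinearMap.range (f.mapMatrix : Matrix m n M₁ →ₗ[K] Matrix m n M₂)) =
      Fintype.card m * Fintype.card n * Module.finrank K (LinearMap.range f) := by
  classical
  let T : LinearMap.range (f.mapMatrix : Matrix m n M₁ →ₗ[K] Matrix m n M₂) →ₗ[K] (m → n → LinearMap.range f) :=
    { toFun := fun c i k => ⟨(c : Matrix m n M₂) i k, by
        obtain ⟨c', hc'⟩ := c.2
        exact ⟨c' i k, by rw [← hc']; rfl⟩⟩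
      map_add' := fun c c' => funext fun i => funext fun k => Subtype.ext rfl
      map_smul' := fun a c => funext fun i => funext fun k => Subtype.ext rfl }
  have hT : Function.Bijective T := by
    refine ⟨fun c c' h => Subtype.ext (Matrix.ext fun i k => ?_), fun g => ?_⟩
    · exact congrArg Subtype.val (congr_fun (congr_fun h i) k)
    · have hg : ∀ i k, ∃ x, f x = (g i k : M₂) := fun i k => LinearMap.mem_range.1 (g i k).2
      choose x hx using hg
      exact ⟨⟨Matrix.of fun i k => (g i k : M₂), ⟨Matrix.of x, Matrix.ext fun i k => hx i k⟩⟩,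
        funext fun i => funext fun k => Subtype.ext rfl⟩
  rw [(LinearEquiv.ofBijective T hT).finrank_eq, Module.finrank_pi_fintype, Finset.sum_const, Finset.card_univ, smul_eq_mul,
    Module.finrank_pi_fintype, Finset.sum_const, Finset.card_univ, smul_eq_mul, mul_assoc]

/-- **«commuting with the action of `F`»**: a `K`-linear self-map of `K ⊗ V` lies in the commutant `C_K(F)` of `ι_K(K ⊗_ℚ F)` iff it
commutes with every `ι(a)_K`, `a ∈ F` (`ι_K` is `K`-spanned by the `ι(a)_K = ι_K(1 ⊗ a)`). [cite: Milne1999LefschetzClasses, §2 p. 646 L52–L54 and §1 p. 644 L16–L18] -/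
theorem mem_centralizer_range_baseChangeAction_iff (γ : Module.End K (K ⊗[ℚ] V)) :
    γ ∈ Subalgebra.centralizer K (Set.range (baseChangeAction K A.ι)) ↔
      ∀ (a : F) (x : K ⊗[ℚ] V), γ ((A.ι a).baseChange K x) = (A.ι a).baseChange K (γ x) := by
  rw [Subalgebra.mem_centralizer_iff]
  constructor
  · intro h a x
    have h1 := h _ ⟨(1 : K) ⊗ₜ[ℚ] a, rfl⟩
    rw [baseChangeAction_one_tmul] at h1
    exact (LinearMap.congr_fun h1 x).symm
  · rintro h _ ⟨u, rfl⟩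
    exact LinearMap.ext fun x => (forall_baseChangeAction_comm_of_forall_baseChange_comm A.ι h u x).symm

/-- **«`αᵢ : Vᵢ → Vᵢ`»**: a map commuting with the action of `F` preserves every `ι_K(u)(K ⊗ V)` (e.g. `Vᵢ = eᵢV`) and every
`ker ι_K(u)`. [cite: Milne1999LefschetzClasses, §2 p. 646 L52–L54] -/
theorem map_range_baseChangeAction_le_of_mem_centralizer {γ : Module.End K (K ⊗[ℚ] V)}
    (hγ : γ ∈ Subalgebra.centralizer K (Set.range (baseChangeAction K A.ι))) (u : K ⊗[ℚ] F) :
    Submodule.map γ (LinearMap.range (baseChangeAction K A.ι u)) ≤ LinearMap.range (baseChangeAction K A.ι u) ∧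
      Submodule.map γ (LinearMap.ker (baseChangeAction K A.ι u)) ≤ LinearMap.ker (baseChangeAction K A.ι u) := by
  have hc : baseChangeAction K A.ι u * γ = γ * baseChangeAction K A.ι u :=
    (Subalgebra.mem_centralizer_iff K).1 hγ _ ⟨u, rfl⟩
  constructor
  · rintro _ ⟨_, ⟨x, rfl⟩, rfl⟩
    refine ⟨γ x, ?_⟩
    change (baseChangeAction K A.ι u * γ) x = (γ * baseChangeAction K A.ι u) x
    rw [hc]
  · rintro _ ⟨x, hx, rfl⟩
    have hx' : baseChangeAction K A.ι u x = 0 := hx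
    show (baseChangeAction K A.ι u * γ) x = 0
    rw [hc, Module.End.mul_apply, hx', map_zero]

/-- **«`α = α₁ ⊕ ⋯ ⊕ α_t`»**: with `1 = e₁ + ⋯ + e_t` in `K ⊗_ℚ F`, every `γ` is the sum of its block components `αᵢ = γ ι_K(eᵢ)`.
[cite: Milne1999LefschetzClasses, §2 p. 646 L45–L54] -/
theorem eq_sum_mul_baseChangeAction {ι : Type*} (s : Finset ι) {e : ι → K ⊗[ℚ] F} (he : ∑ i ∈ s, e i = 1)
    (γ : Module.End K (K ⊗[ℚ] V)) : γ = ∑ i ∈ s, γ * baseChangeAction K A.ι (e i) := by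
  rw [← Finset.mul_sum, ← map_sum, he, map_one, mul_one]

variable [Module.Finite ℚ V]

/-- **THE COMMUTANT OF `F` ON `K ⊗ V` IS A MATRIX ALGEBRA OVER `K ⊗_ℚ F`, FOR EVERY FIELD `K ⊇ ℚ`: `C_K(F) ≃ₐ[K] M_d(K ⊗_ℚ F)`,
`d·[F:ℚ] = dim_ℚ V`**, via `Φ(M) = Ψ ∘ (M *ᵥ ·) ∘ Ψ⁻¹` for g20's `(K ⊗ F)`-linear bijection `Ψ : (K ⊗ F)^d ≅ K ⊗ V`, with
`Φ(u • M) = ι_K(u) Φ(M)` — Milne's «`C(A) = C₁ × ⋯ × C_t`, `Cᵢ = End_{Fᵢ}(Vᵢ) ≈ M_{2g/f}(Fᵢ)`» for all factors at once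
(`M_d(F ⊗ k) = ∏ᵢ M_d(Fᵢ)`), without splitting `K`. [cite: Milne1999LefschetzClasses, §2 p. 648 L42–L52 («Cᵢ = End_{Fᵢ}(Vᵢ) ≈ M_{2g/f}(Fᵢ)») and p. 646 L52–L54, Prop. 2.1 p. 647] -/
theorem exists_matrix_algEquiv_centralizer_range_baseChangeAction :
    ∃ (d : ℕ) (Φ : Matrix (Fin d) (Fin d) (K ⊗[ℚ] F) ≃ₐ[K]
        Subalgebra.centralizer K (Set.range (baseChangeAction K A.ι))),
      d * Module.finrank ℚ F = Module.finrank ℚ V ∧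
      ∀ (u : K ⊗[ℚ] F) (M : Matrix (Fin d) (Fin d) (K ⊗[ℚ] F)),
        ((Φ (u • M) : Subalgebra.centralizer K (Set.range (baseChangeAction K A.ι))) : Module.End K (K ⊗[ℚ] V)) =
          baseChangeAction K A.ι u * (Φ M : Module.End K (K ⊗[ℚ] V)) := by
  classical
  obtain ⟨d, v, hd, hbij⟩ := A.exists_bijective_sum_baseChange_apply_ι K
  -- the `K`-linear bijection `Ψ : (K ⊗ F)^d → K ⊗ V` of g20 as a linear equivalence
  let θ : Fin d → (K ⊗[ℚ] F →ₗ[K] K ⊗[ℚ] V) := fun j => (LinearMap.applyₗ (v j) ∘ₗ A.ι.toLinearMap).baseChange K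
  let Ψₗ : (Fin d → K ⊗[ℚ] F) →ₗ[K] K ⊗[ℚ] V := ∑ j, θ j ∘ₗ LinearMap.proj j
  have hΨ : ∀ c, Ψₗ c = ∑ j, θ j (c j) := fun c => by
    simp only [Ψₗ, LinearMap.sum_apply, LinearMap.comp_apply, LinearMap.proj_apply]
  have hbijₗ : Function.Bijective Ψₗ :=
    ⟨fun a b h => hbij.1 (show (∑ j, θ j (a j)) = ∑ j, θ j (b j) by rw [← hΨ, ← hΨ]; exact h),
      fun y => (hbij.2 y).imp fun c hc => (hΨ c).trans hc⟩
  let Ψ : (Fin d → K ⊗[ℚ] F) ≃ₗ[K] K ⊗[ℚ] V := LinearEquiv.ofBijective Ψₗ hbijₗ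
  have hΨapply : ∀ c, Ψ c = ∑ j, θ j (c j) := hΨ
  -- `Ψ` is `(K ⊗ F)`-linear for `ι_K`
  have hΨsmul : ∀ (u : K ⊗[ℚ] F) (c : Fin d → K ⊗[ℚ] F), Ψ (u • c) = baseChangeAction K A.ι u (Ψ c) := by
    intro u c
    rw [hΨapply, hΨapply, map_sum]
    exact Finset.sum_congr rfl fun j _ => A.baseChange_apply_ι_mul K (v j) u (c j)
  have hΨsymm : ∀ (u : K ⊗[ℚ] F) (x : K ⊗[ℚ] V), Ψ.symm (baseChangeAction K A.ι u x) = u • Ψ.symm x := by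
    intro u x
    apply Ψ.injective
    rw [LinearEquiv.apply_symm_apply, hΨsmul, LinearEquiv.apply_symm_apply]
  -- `Γ M = Ψ ∘ (M *ᵥ ·) ∘ Ψ⁻¹`
  let Γ : Matrix (Fin d) (Fin d) (K ⊗[ℚ] F) → Module.End K (K ⊗[ℚ] V) := fun M =>
    Ψ.toLinearMap ∘ₗ ((Matrix.mulVecLin M).restrictScalars K) ∘ₗ Ψ.symm.toLinearMap
  have hΓ : ∀ M x, Γ M x = Ψ (M.mulVec (Ψ.symm x)) := fun M x => rfl
  let Γₗ : Matrix (Fin d) (Fin d) (K ⊗[ℚ] F) →ₗ[K] Module.End K (K ⊗[ℚ] V) :=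
    { toFun := Γ
      map_add' := fun M N => LinearMap.ext fun x => by
        rw [LinearMap.add_apply, hΓ, hΓ, hΓ, Matrix.add_mulVec, map_add]
      map_smul' := fun k M => LinearMap.ext fun x => by
        rw [RingHom.id_apply, LinearMap.smul_apply, hΓ, hΓ, Matrix.smul_mulVec, map_smul] }
  have hΓₗ : ∀ M, Γₗ M = Γ M := fun M => rfl
  have hone : Γₗ 1 = 1 := LinearMap.ext fun x => by
    change Γ 1 x = x
    rw [hΓ, Matrix.one_mulVec, LinearEquiv.apply_symm_apply]
  have hmul : ∀ M N, Γₗ (M * N) = Γₗ M * Γₗ N := fun M N => LinearMap.ext fun x => by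
    change Γ (M * N) x = Γ M (Γ N x)
    rw [hΓ, hΓ, hΓ, LinearEquiv.symm_apply_apply, Matrix.mulVec_mulVec]
  let φ : Matrix (Fin d) (Fin d) (K ⊗[ℚ] F) →ₐ[K] Module.End K (K ⊗[ℚ] V) := AlgHom.ofLinearMap Γₗ hone hmul
  have hφ : ∀ M, φ M = Γ M := fun M => rfl
  -- `Γ (u • M) = ι_K(u) Γ M`
  have hsmul : ∀ (u : K ⊗[ℚ] F) (M : Matrix (Fin d) (Fin d) (K ⊗[ℚ] F)),
      Γ (u • M) = baseChangeAction K A.ι u * Γ M := fun u M => LinearMap.ext fun x => by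
    rw [Module.End.mul_apply, hΓ, hΓ, Matrix.smul_mulVec, hΨsmul]
  -- the values commute with `ι_K`
  have hmem : ∀ M, φ M ∈ Subalgebra.centralizer K (Set.range (baseChangeAction K A.ι)) := by
    intro M
    rw [Subalgebra.mem_centralizer_iff]
    rintro _ ⟨u, rfl⟩
    refine LinearMap.ext fun x => ?_
    rw [hφ, Module.End.mul_apply, Module.End.mul_apply, hΓ, hΓ, hΨsymm, Matrix.mulVec_smul, hΨsmul]
  let φc := φ.codRestrict (Subalgebra.centralizer K (Set.range (baseChangeAction K A.ι))) hmem
  have hφc : ∀ M, ((φc M : Subalgebra.centralizer K (Set.range (baseChangeAction K A.ι))) :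
      Module.End K (K ⊗[ℚ] V)) = Γ M := fun M => rfl
  -- injective
  have hinj : Function.Injective φc := by
    refine (injective_iff_map_eq_zero _).2 fun M hM => ?_
    have hM' : Γ M = 0 := by rw [← hφc, hM]; rfl
    have hlin : Matrix.toLin' M = 0 := by
      refine LinearMap.ext fun c => ?_
      have h := LinearMap.congr_fun hM' (Ψ c)
      rw [hΓ, LinearEquiv.symm_apply_apply, LinearMap.zero_apply, LinearEquiv.map_eq_zero_iff] at h
      rw [Matrix.toLin'_apply, LinearMap.zero_apply, h]
    exact Matrix.toLin'.map_eq_zero_iff.1 hlin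
  -- surjective: `γ = Γ M` with column `j` of `M` equal to `Ψ⁻¹ (γ (Ψ eⱼ))`
  have hsurj : Function.Surjective φc := by
    intro γ
    have hγc : ∀ u, baseChangeAction K A.ι u * (γ : Module.End K (K ⊗[ℚ] V)) =
        (γ : Module.End K (K ⊗[ℚ] V)) * baseChangeAction K A.ι u := fun u =>
      (Subalgebra.mem_centralizer_iff K).1 γ.2 _ ⟨u, rfl⟩
    let M : Matrix (Fin d) (Fin d) (K ⊗[ℚ] F) := fun i j =>
      Ψ.symm ((γ : Module.End K (K ⊗[ℚ] V)) (Ψ (Pi.single j 1))) i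
    refine ⟨M, Subtype.ext ?_⟩
    rw [hφc]
    refine LinearMap.ext fun x => ?_
    obtain ⟨c, rfl⟩ := Ψ.surjective x
    rw [hΓ, LinearEquiv.symm_apply_apply]
    -- `M *ᵥ c = Σ_j c_j • Ψ⁻¹ (γ (Ψ e_j))`
    have hMc : M.mulVec c = ∑ j, c j • Ψ.symm ((γ : Module.End K (K ⊗[ℚ] V)) (Ψ (Pi.single j 1))) := by
      funext i
      rw [Finset.sum_apply]
      simp only [Matrix.mulVec, dotProduct, M, Pi.smul_apply, smul_eq_mul, mul_comm]
    have hc : c = ∑ j, c j • (Pi.single j (1 : K ⊗[ℚ] F) : Fin d → K ⊗[ℚ] F) := by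
      funext l
      rw [Finset.sum_apply]
      simp only [Pi.smul_apply, Pi.single_apply, smul_eq_mul, mul_ite, mul_one, mul_zero]
      rw [Finset.sum_ite_eq Finset.univ l, if_pos (Finset.mem_univ l)]
    rw [hMc, map_sum]
    calc ∑ j, Ψ (c j • Ψ.symm ((γ : Module.End K (K ⊗[ℚ] V)) (Ψ (Pi.single j 1))))
        = ∑ j, (γ : Module.End K (K ⊗[ℚ] V)) (Ψ (c j • (Pi.single j (1 : K ⊗[ℚ] F) : Fin d → K ⊗[ℚ] F))) := by
          refine Finset.sum_congr rfl fun j _ => ?_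
          rw [hΨsmul, LinearEquiv.apply_symm_apply, hΨsmul, ← Module.End.mul_apply, hγc, Module.End.mul_apply]
      _ = (γ : Module.End K (K ⊗[ℚ] V)) (Ψ (∑ j, c j • (Pi.single j (1 : K ⊗[ℚ] F) : Fin d → K ⊗[ℚ] F))) := by
          rw [map_sum, map_sum]
      _ = (γ : Module.End K (K ⊗[ℚ] V)) (Ψ c) := by rw [← hc]
  refine ⟨d, AlgEquiv.ofBijective φc ⟨hinj, hsurj⟩, hd, fun u M => ?_⟩
  rw [AlgEquiv.ofBijective_apply, AlgEquiv.ofBijective_apply, hφc, hφc, hsmul]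

/-- **`dim_K C_K(F) = d² · [F : ℚ]`**, `d = dim_ℚ V/[F:ℚ]`, for EVERY field `K ⊇ ℚ` — the dimension of `M_d(K ⊗_ℚ F)`; independent of
`K` («`C'(A) ≅ C(A) ⊗_k k'`»). [cite: Milne1999LefschetzClasses, §2 p. 648 L50 and §1 Remark 1.6 (p. 644)] -/
theorem finrank_centralizer_range_baseChangeAction :
    Module.finrank K (Subalgebra.centralizer K (Set.range (baseChangeAction K A.ι))) =
      (Module.finrank ℚ V / Module.finrank ℚ F) ^ 2 * Module.finrank ℚ F := by
  obtain ⟨d, Φ, hd, -⟩ := A.exists_matrix_algEquiv_centralizer_range_baseChangeAction K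
  rw [Nat.div_eq_of_eq_mul_left Module.finrank_pos hd.symm, ← Φ.toLinearEquiv.finrank_eq,
    show Module.finrank K (Matrix (Fin d) (Fin d) (K ⊗[ℚ] F)) = Module.finrank K (Fin d → Fin d → K ⊗[ℚ] F) from rfl,
    Module.finrank_pi_fintype, Finset.sum_const, Finset.card_univ, Fintype.card_fin, smul_eq_mul,
    Module.finrank_pi_fintype, Finset.sum_const, Finset.card_univ, Fintype.card_fin, smul_eq_mul,
    Module.finrank_baseChange, sq, mul_assoc]

/-- **THE BLOCK COMMUTANT `Cᵤ = C_K(F)·ι_K(u)` HAS `dim_K Cᵤ = d² · dim_K u·(K ⊗ F)`** for every `u ∈ K ⊗_ℚ F` (`Φ⁻¹(Cᵤ) = u • M_d(K ⊗ F)`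
`= M_d(u·(K ⊗ F))`; for `u = eᵢ`: «`Cᵢ = End_{Fᵢ}(Vᵢ) ≈ M_{2g/f}(Fᵢ)`», `Fᵢ = eᵢ(K ⊗ F)`). [cite: Milne1999LefschetzClasses, §2 p. 648 L42–L52] -/
theorem finrank_map_mulRight_centralizer_eq (u : K ⊗[ℚ] F) :
    Module.finrank K (Submodule.map (LinearMap.mulRight K (baseChangeAction K A.ι u))
        (Subalgebra.toSubmodule (Subalgebra.centralizer K (Set.range (baseChangeAction K A.ι))))) =
      (Module.finrank ℚ V / Module.finrank ℚ F) ^ 2 * Module.finrank K (LinearMap.range (LinearMap.mulLeft K u)) := by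
  obtain ⟨d, Φ, hd, hΦ⟩ := A.exists_matrix_algEquiv_centralizer_range_baseChangeAction K
  rw [Nat.div_eq_of_eq_mul_left Module.finrank_pos hd.symm]
  let j : Matrix (Fin d) (Fin d) (K ⊗[ℚ] F) →ₗ[K] Module.End K (K ⊗[ℚ] V) :=
    (Subalgebra.centralizer K (Set.range (baseChangeAction K A.ι))).val.toLinearMap ∘ₗ Φ.toLinearEquiv.toLinearMap
  have hj : ∀ M, j M = ((Φ M : Subalgebra.centralizer K (Set.range (baseChangeAction K A.ι))) :
      Module.End K (K ⊗[ℚ] V)) := fun M => rfl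
  have hjinj : Function.Injective j := fun M N h => Φ.injective (Subtype.ext (by rwa [hj, hj] at h))
  have hg : ∀ M : Matrix (Fin d) (Fin d) (K ⊗[ℚ] F), (LinearMap.mulLeft K u).mapMatrix M = u • M := fun M =>
    Matrix.ext fun i k => rfl
  have hmap : Submodule.map (LinearMap.mulRight K (baseChangeAction K A.ι u))
      (Subalgebra.toSubmodule (Subalgebra.centralizer K (Set.range (baseChangeAction K A.ι)))) =
      (LinearMap.range ((LinearMap.mulLeft K u).mapMatrix :
        Matrix (Fin d) (Fin d) (K ⊗[ℚ] F) →ₗ[K] Matrix (Fin d) (Fin d) (K ⊗[ℚ] F))).map j := by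
    ext γ'
    rw [Submodule.mem_map, Submodule.mem_map]
    constructor
    · rintro ⟨γ, hγ, rfl⟩
      obtain ⟨M, hM⟩ := Φ.surjective ⟨γ, hγ⟩
      refine ⟨u • M, ⟨M, rfl⟩, ?_⟩
      rw [hj, hΦ, LinearMap.mulRight_apply, hM]
      exact (Subalgebra.mem_centralizer_iff K).1 hγ _ ⟨u, rfl⟩
    · rintro ⟨_, ⟨M, rfl⟩, rfl⟩
      refine ⟨((Φ M : Subalgebra.centralizer K (Set.range (baseChangeAction K A.ι))) : Module.End K (K ⊗[ℚ] V)),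
        (Φ M).2, ?_⟩
      rw [hg, hj, hΦ, LinearMap.mulRight_apply]
      exact ((Subalgebra.mem_centralizer_iff K).1 (Φ M).2 _ ⟨u, rfl⟩).symm
  rw [hmap, ← (Submodule.equivMapOfInjective j hjinj _).finrank_eq, finrank_range_mapMatrix₅₇₅, Fintype.card_fin, sq]

/-- **«`Cᵢ = End_{Fᵢ}(Vᵢ) ≈ M_{2g/f}(Fᵢ)`» COUNTED OVER ANY FIELD `K ⊇ ℚ`: `dim_K C_K(F)·ι_K(e_𝔪) = d² · [(K ⊗ F)/𝔪 : K]`** for the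
primitive idempotent `e_𝔪` (any `e ∉ 𝔪` in all other maximal ideals) at a maximal ideal `𝔪` of `K ⊗_ℚ F` — the factor field
`Fᵢ = (K ⊗ F)/𝔪ᵢ` of any degree over `K` (g56-#13 `finrank_range_mulLeft_eq_finrank_quotient`).
[cite: Milne1999LefschetzClasses, §2 p. 648 L42–L52 and p. 646 L43–L54] -/
theorem finrank_map_mulRight_centralizer_eq_of_notMem (I : MaximalSpectrum (K ⊗[ℚ] F)) {e : K ⊗[ℚ] F}
    (heI : e ∉ I.asIdeal) (heJ : ∀ J : MaximalSpectrum (K ⊗[ℚ] F), J ≠ I → e ∈ J.asIdeal) :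
    Module.finrank K (Submodule.map (LinearMap.mulRight K (baseChangeAction K A.ι e))
        (Subalgebra.toSubmodule (Subalgebra.centralizer K (Set.range (baseChangeAction K A.ι))))) =
      (Module.finrank ℚ V / Module.finrank ℚ F) ^ 2 * Module.finrank K ((K ⊗[ℚ] F) ⧸ I.asIdeal) := by
  haveI := isReduced_baseChange_numberField K F
  rw [A.finrank_map_mulRight_centralizer_eq K e, finrank_range_mulLeft_eq_finrank_quotient K (K ⊗[ℚ] F) I heI heJ]

/-- **«`C(A) ⊗ k = C₁ × ⋯ × C_t`» COUNTED: `Σ_𝔪 dim_K C_K(F)·ι_K(e_𝔪) = dim_K C_K(F)`** for any family of primitive idempotents of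
`K ⊗_ℚ F` (`Σ_𝔪 d²·[(K ⊗ F)/𝔪 : K] = d²·[F:ℚ]`). [cite: Milne1999LefschetzClasses, §2 p. 648 L42–L52 and p. 646 L43–L47] -/
theorem sum_finrank_map_mulRight_centralizer_eq [Fintype (MaximalSpectrum (K ⊗[ℚ] F))]
    {e : MaximalSpectrum (K ⊗[ℚ] F) → K ⊗[ℚ] F}
    (he : ∀ I, e I ∉ I.asIdeal ∧ ∀ J : MaximalSpectrum (K ⊗[ℚ] F), J ≠ I → e I ∈ J.asIdeal) :
    ∑ I, Module.finrank K (Submodule.map (LinearMap.mulRight K (baseChangeAction K A.ι (e I)))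
        (Subalgebra.toSubmodule (Subalgebra.centralizer K (Set.range (baseChangeAction K A.ι))))) =
      Module.finrank K (Subalgebra.centralizer K (Set.range (baseChangeAction K A.ι))) := by
  simp_rw [fun I => A.finrank_map_mulRight_centralizer_eq_of_notMem K I (he I).1 (he I).2]
  rw [← Finset.mul_sum, sum_finrank_quotient_baseChange_eq_finrank K F, A.finrank_centralizer_range_baseChangeAction K]

end EndAction

end HodgeStructure

end Literature.AlgebraicGeometry.Motives
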